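import Summits.ABC.ABC.Theorems.DefiniteXiFreyModularityStubFreyCaseBSixteen
import Literature.NumberTheory.EllipticCurves.SemistableModPImageProofs
import Literature.NumberTheory.Automorphic.BCDTTheoremB
import Literature.NumberTheory.DiophantineGeometry.GeneralizedFermatTwoPowerCoefficientFreyProofs
import HarnessLib

/-!
# Crux `FreyModularity` (stmt-ABC-11340), line `Sketch`: in case B the Frey curve is semistable,
# multiplicative at `3`, and `ρ̄_{E,3}` is reducible with a trivial constituent

Support file for the crux `Summit.ABC.ABC.Theses.DefiniteXi.FreyModularity` (every Frey curve
`E_(a,b) : y² = x(x - a)(x + b)` is modular), line `Sketch`, registered side stubs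
`stub_freyCaseBThreeReducible` (S14) and `stub_freyCaseBMultiplicativeThree` (S15) of reshape 7
(lead `c52`).  The composition of the line (Conrad–Diamond–Taylor 1999, proof of Thm. 7.1.2,
p. 556) splits on **case A** — some framed model of `E[3]` is absolutely irreducible over
`ℚ(√-3)` (Langlands–Tunnell and lifting at `3`) — versus **case B** (Wiles' `3`–`5` switch and
lifting at `5`).  Reshape 6 (`stub_freyCaseBSixteen`, p158268) proved that on the normalised Frey
family (`A ≡ -1 (mod 4)`, `2 ∣ B`) case B forces `16 ∣ B`, i.e. semistability at every prime.
This file finishes the description of case B: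

* `surjective_of_hasSurjectiveModNGaloisRep` — if the abstract mod-`p` representation
  `Γ_ℚ → Aut(E[p])` is onto (`HasSurjectiveModNGaloisRep`), every framed model
  `ρ̄ : Γ_ℚ →ₜ* GL₂(𝔽_p)` of `E[p]` is onto (push `e⁻¹ ∘ M ∘ e` through the frame `e`);
* `not_hasSurjectiveModNGaloisRep_three_of_caseB` — in case B, `ρ̄_{E,3}` is not onto (an onto
  `ρ̄_{E,3}` is absolutely irreducible on `Γ_{ℚ(√-3)}`, `isAbsIrreducibleOverSqrt_neg_three_of_surjective`);
* `exists_stableLine_three_of_isSemistable_of_caseB` — for a SEMISTABLE `E/ℚ` in case B, `E[3]`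
  has a `Γ_ℚ`-stable line `H` with `Γ_ℚ` trivial on `H` or on `E[3]/H` (`ρ̄_{E,3}^{ss} = 1 ⊕ χ̄₃`):
  Serre 1972, §5.4 Prop. 21 = Edixhoven 1997, Prop. 2.1, a THEOREM of the tree
  (`Edixhoven1997_prop_2_1_holds`);
* `stub_freyCaseBThreeReducible` (S14) — on the normalised Frey family, case B ⇒ such a line
  exists (`stub_freyCaseBSixteen` ⇒ `16 ∣ B` ⇒ `isSemistable_freyCurve_of_sixteen_dvd`);
* `stub_freyCaseBMultiplicativeThree` (S15) — for EVERY Frey curve (`a ⊥ b`, `ab(a+b) ≠ 0`),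
  case B ⇒ `3 ∣ ab(a+b)` (R3: `3 ∤ abc` gives case A,
  `isAbsIrreducibleOverSqrt_negThree_freyCurve_of_not_three_dvd`) and `E_(a,b)` has multiplicative
  reduction at `3` (`hasMultiplicativeReductionAt_freyCurve_of_ne_two`).

Together with S12: a case-B Frey curve is semistable, multiplicative (= ordinary) at `3`, and
`ρ̄_{E,3}^{ss} = 1 ⊕ χ̄₃` — verbatim the setting of the residually REDUCIBLE ordinary modularity
lifting theorem of Skinner–Wiles (Publ. IHÉS 89 (1999)) at `p = 3`, which is the case split of the
switch-free architecture recorded in the crux idea `single-prime-three`; and the exact scope of the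
switch `stub_switch` in the present line (Wiles 1995, Ch. 5: semistable curves with `ρ̄_{E,3}`
reducible).  These are side results: they do not feed `FreyModularity_of`.  Nothing is defined; no
named fact is used.

## References

* [Serre1972] J.-P. Serre, Invent. Math. 15 (1972), §5.4 Prop. 21.
* [Edixhoven1997] B. Edixhoven, *Serre's conjecture*, in Cornell–Silverman–Stevens (1997),
  Prop. 2.1 (PDF p. 285).
* [DiamondKramer1995] F. Diamond, K. Kramer, Math. Res. Lett. 2 (1995), Lemmas 1–3.
* [Wiles1995Annals] A. Wiles, Ann. of Math. 141 (1995), Ch. 5.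
* [SkinnerWiles1999] C. Skinner, A. Wiles, Publ. Math. IHÉS 89 (1999), Theorem (Introduction).
-/

-- `Summit.<Summit>.<Problem>` is the mandated summit-side namespace (CONVENTIONS §2); for the
-- single-conjunct summit `ABC` the two coincide, so the duplicate `ABC.ABC` is deliberate.
set_option linter.dupNamespace false

noncomputable section

open scoped MatrixGroups NumberField

open Matrix Field IsDedekindDomain
open Literature.NumberTheory.EllipticCurves
open Literature.NumberTheory.Automorphic
open Literature.NumberTheory.Automorphic.BCDT
open Literature.NumberTheory.GaloisRepresentations
open Literature.NumberTheory.DiophantineGeometry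
open WeierstrassCurve

namespace Summit.ABC.ABC.Theorems

/-! ## Abstract surjectivity ⇒ framed surjectivity -/

/-- **If `Γ_ℚ → Aut(E[p])` is onto, every framed model `ρ̄` of `E[p]` is onto `GL₂(𝔽_p)`.**  Given
`M ∈ GL₂(𝔽_p)` and the equivariant frame `e : E[p] ≃ 𝔽_p²` (`e(σ • P) = ρ̄(σ) e(P)`), the additive
automorphism `e⁻¹ ∘ M ∘ e` of `E[p]` is `σ • ·` for some `σ ∈ Γ_F` (surjectivity of
`galoisRepTorsion`), and then `ρ̄(σ) v = e(σ • e⁻¹ v) = M v` for every `v`, so `ρ̄(σ) = M`. [folklore] -/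
theorem surjective_of_hasSurjectiveModNGaloisRep {F : Type} [Field F] {W : WeierstrassCurve F}
    {p : ℕ} [Fact p.Prime] (hs : W.HasSurjectiveModNGaloisRep (p : ℤ)) {ρ : ModPGaloisRep F (ZMod p) 2}
    (hρ : W.IsTorsionGaloisRep p ρ) : Function.Surjective ρ := by
  obtain ⟨e, he⟩ := hρ
  intro M
  -- the additive automorphism `v ↦ M v` of `𝔽_p²`
  let f : (Fin 2 → ZMod p) ≃+ (Fin 2 → ZMod p) :=
    { toFun := fun v ↦ (M : Matrix (Fin 2) (Fin 2) (ZMod p)) *ᵥ v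
      invFun := fun v ↦ ((M⁻¹ : GL (Fin 2) (ZMod p)) : Matrix (Fin 2) (Fin 2) (ZMod p)) *ᵥ v
      left_inv := fun v ↦ by
        simp only [Matrix.mulVec_mulVec, Units.inv_mul, Matrix.one_mulVec]
      right_inv := fun v ↦ by
        simp only [Matrix.mulVec_mulVec, Units.mul_inv, Matrix.one_mulVec]
      map_add' := fun v w ↦ Matrix.mulVec_add _ _ _ }
  have hf : ∀ v, f v = (M : Matrix (Fin 2) (Fin 2) (ZMod p)) *ᵥ v := fun _ ↦ rfl
  -- `e⁻¹ ∘ M ∘ e` is `σ • ·` for some `σ`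
  obtain ⟨σ, hσ⟩ := hs (Multiplicative.ofAdd (e.trans (f.trans e.symm)))
  have hσP : ∀ P : geomTorsion W p, σ • P = e.symm (f (e P)) := fun P ↦ by
    have h := W.galoisRepTorsion_apply (p : ℤ) σ P
    rw [hσ, toAdd_ofAdd] at h
    exact h.symm
  refine ⟨σ, ?_⟩
  -- compare the two matrices on every vector
  have hv : ∀ v : Fin 2 → ZMod p,
      ((ρ σ : GL (Fin 2) (ZMod p)) : Matrix (Fin 2) (Fin 2) (ZMod p)) *ᵥ v =
        (M : Matrix (Fin 2) (Fin 2) (ZMod p)) *ᵥ v := fun v ↦ by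
    have h := he σ (e.symm v)
    rw [hσP, AddEquiv.apply_symm_apply, AddEquiv.apply_symm_apply, hf] at h
    exact h.symm
  have hmat : ((ρ σ : GL (Fin 2) (ZMod p)) : Matrix (Fin 2) (Fin 2) (ZMod p)) =
      (M : Matrix (Fin 2) (Fin 2) (ZMod p)) :=
    Matrix.toLin'.injective (LinearMap.ext fun v ↦ by rw [Matrix.toLin'_apply, Matrix.toLin'_apply, hv])
  exact Units.ext hmat

/-! ## Case B: `ρ̄_{E,3}` is not onto; for semistable `E` it is reducible with a trivial constituent -/

/-- **In case B the mod-`3` representation is not onto.**  If no framed model of `E[3]` is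
absolutely irreducible over `ℚ(√-3)`, then `Γ_ℚ → Aut(E[3])` is not surjective: a framed model
exists (`exists_isTorsionGaloisRep`), it would be onto `GL₂(𝔽₃)`
(`surjective_of_hasSurjectiveModNGaloisRep`), and an onto `ρ̄ : Γ_ℚ → GL₂(𝔽₃)` is absolutely
irreducible on `Γ_{ℚ(√-3)}` (`isAbsIrreducibleOverSqrt_neg_three_of_surjective`: its image there
contains `SL₂(𝔽₃)`). [cite: ConradDiamondTaylor1999, proof of Thm. 7.1.2 (p. 556)] -/
theorem not_hasSurjectiveModNGaloisRep_three_of_caseB (W : WeierstrassCurve ℚ) [W.IsElliptic]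
    (hB : ∀ ρ₃ : ModPGaloisRep ℚ (ZMod 3) 2, W.IsTorsionGaloisRep 3 ρ₃ →
      ¬ ρ₃.IsAbsIrreducibleOverSqrt (-3)) :
    ¬ W.HasSurjectiveModNGaloisRep ((3 : ℕ) : ℤ) := by
  intro hs
  haveI : Fact (Nat.Prime 3) := ⟨Nat.prime_three⟩
  haveI : NeZero ((3 : ℕ) : ℚ) := ⟨by norm_num⟩
  obtain ⟨ρ, hρ⟩ := W.exists_isTorsionGaloisRep 3
  exact hB ρ hρ (isAbsIrreducibleOverSqrt_neg_three_of_surjective ρ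
    (surjective_of_hasSurjectiveModNGaloisRep hs hρ))

/-- **A semistable `E/ℚ` in case B has `ρ̄_{E,3}` reducible with semi-simplification `1 ⊕ χ̄₃`.**
For a semistable elliptic curve `E/ℚ` with no framed model of `E[3]` absolutely irreducible over
`ℚ(√-3)`, there is a `Γ_ℚ`-stable subgroup `H` of `E[3]`, `H ≠ 0, E[3]` (a stable line), which
`Γ_ℚ` fixes pointwise or modulo which it acts trivially on `E[3]`.  This is Serre 1972, §5.4
Prop. 21 (Edixhoven 1997, Prop. 2.1, after Oesterlé at `p = 3`) — "`ρ̄_p` is surjective, or it is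
reducible with semi-simplification `1 ⊕ χ_p`" — a THEOREM of the tree
(`Edixhoven1997_prop_2_1_holds`), the surjective alternative being excluded by case B
(`not_hasSurjectiveModNGaloisRep_three_of_caseB`).
[cite: Serre1972, §5.4 Prop. 21] [cite: Edixhoven1997, Prop. 2.1 (PDF p. 285)] -/
theorem exists_stableLine_three_of_isSemistable_of_caseB (W : WeierstrassCurve ℚ) [W.IsElliptic]
    (hss : W.IsSemistable ℤ)
    (hB : ∀ ρ₃ : ModPGaloisRep ℚ (ZMod 3) 2, W.IsTorsionGaloisRep 3 ρ₃ →
      ¬ ρ₃.IsAbsIrreducibleOverSqrt (-3)) :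
    ∃ H : AddSubgroup (geomTorsion W (3 : ℕ)),
      (∀ σ : absoluteGaloisGroup ℚ, ∀ P ∈ H, σ • P ∈ H) ∧ H ≠ ⊥ ∧ H ≠ ⊤ ∧
      ((∀ σ : absoluteGaloisGroup ℚ, ∀ P ∈ H, σ • P = P) ∨
        ∀ (σ : absoluteGaloisGroup ℚ) (Q : geomTorsion W (3 : ℕ)), σ • Q - Q ∈ H) := by
  rcases Edixhoven1997_prop_2_1_holds W hss 3 Nat.prime_three with hs | h
  · exact absurd hs (not_hasSurjectiveModNGaloisRep_three_of_caseB W hB)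
  · exact h

/-! ## The Frey family in case B -/

/-- **Case B on the normalised Frey family: `ρ̄_{E,3}` is reducible with a trivial constituent**
(curried form).  For coprime `A, B` with `AB(A+B) ≠ 0`, `A ≡ -1 (mod 4)`, `2 ∣ B` and no framed
model of `E_(A,B)[3]` absolutely irreducible over `ℚ(√-3)`: `16 ∣ B` (`stub_freyCaseBSixteen`,
Diamond–Kramer), so `E_(A,B)` is semistable at every prime
(`isSemistable_freyCurve_of_sixteen_dvd`), and Serre's Prop. 21 applies
(`exists_stableLine_three_of_isSemistable_of_caseB`).
[cite: Serre1972, §5.4 Prop. 21] [cite: DiamondKramer1995, Lemmas 1–3] -/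
theorem exists_stableLine_three_freyCurve_of_caseB {A B : ℤ} (hAB : IsCoprime A B)
    (h0 : A * B * (A + B) ≠ 0) (hA : A ≡ -1 [ZMOD 4]) (h2 : (2 : ℤ) ∣ B)
    (hB : ∀ ρ₃ : ModPGaloisRep ℚ (ZMod 3) 2, (freyCurve A B).IsTorsionGaloisRep 3 ρ₃ →
      ¬ ρ₃.IsAbsIrreducibleOverSqrt (-3)) :
    ∃ H : AddSubgroup (geomTorsion (freyCurve A B) (3 : ℕ)),
      (∀ σ : absoluteGaloisGroup ℚ, ∀ P ∈ H, σ • P ∈ H) ∧ H ≠ ⊥ ∧ H ≠ ⊤ ∧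
      ((∀ σ : absoluteGaloisGroup ℚ, ∀ P ∈ H, σ • P = P) ∨
        ∀ (σ : absoluteGaloisGroup ℚ) (Q : geomTorsion (freyCurve A B) (3 : ℕ)), σ • Q - Q ∈ H) := by
  haveI := isElliptic_freyCurve h0
  have h16 : (16 : ℤ) ∣ B := stub_freyCaseBSixteen A B hAB h0 hA h2 hB
  exact exists_stableLine_three_of_isSemistable_of_caseB (freyCurve A B)
    (isSemistable_freyCurve_of_sixteen_dvd hAB h0 hA h16) hB

/-- **Registered stub `stub_freyCaseBThreeReducible` (crux `FreyModularity`, line `Sketch`, S14,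
reshape 7): on the normalised Frey family, case B forces `ρ̄_{E,3}` to be reducible with
semi-simplification `1 ⊕ χ̄₃`.**  For coprime `A, B` with `AB(A+B) ≠ 0`, `A ≡ -1 (mod 4)`,
`2 ∣ B`: if no framed model of `E_(A,B)[3]` is absolutely irreducible over `ℚ(√-3)`, then `E[3]`
has a `Γ_ℚ`-stable line `H` fixed pointwise by `Γ_ℚ` or with `Γ_ℚ` acting trivially on `E[3]/H`
(so `E_(A,B)` or its `3`-isogenous quotient `E/H` has a rational point of order `3` and, having
full rational `2`-torsion, lies in Kubert's genus-`0` family `ℤ/2 × ℤ/6`).  With S12 (`16 ∣ B`: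
semistable) and S15 (multiplicative at `3`) this is exactly the setting of Wiles 1995, Ch. 5 —
the only place the `3`–`5` switch of the line is consumed — and of the residually reducible
ordinary lifting theorem of Skinner–Wiles 1999 at `p = 3`.  Side stub; does not feed
`FreyModularity_of`.  `exists_stableLine_three_freyCurve_of_caseB`, uncurried.
[cite: Serre1972, §5.4 Prop. 21] [cite: Wiles1995Annals, Ch. 5] -/
theorem stub_freyCaseBThreeReducible :
    ∀ (A B : ℤ) [(freyCurve A B).IsElliptic], IsCoprime A B → A * B * (A + B) ≠ 0 →
      A ≡ -1 [ZMOD 4] → (2 : ℤ) ∣ B →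
      (∀ ρ₃ : ModPGaloisRep ℚ (ZMod 3) 2, (freyCurve A B).IsTorsionGaloisRep 3 ρ₃ →
        ¬ ρ₃.IsAbsIrreducibleOverSqrt (-3)) →
      ∃ H : AddSubgroup (geomTorsion (freyCurve A B) (3 : ℕ)),
        (∀ σ : Field.absoluteGaloisGroup ℚ, ∀ P ∈ H, σ • P ∈ H) ∧ H ≠ ⊥ ∧ H ≠ ⊤ ∧
        ((∀ σ : Field.absoluteGaloisGroup ℚ, ∀ P ∈ H, σ • P = P) ∨
          ∀ (σ : Field.absoluteGaloisGroup ℚ) (Q : geomTorsion (freyCurve A B) (3 : ℕ)),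
            σ • Q - Q ∈ H) :=
  fun _ _ _ hAB h0 hA h2 hB ↦ exists_stableLine_three_freyCurve_of_caseB hAB h0 hA h2 hB

/-- **Registered stub `stub_freyCaseBMultiplicativeThree` (crux `FreyModularity`, line `Sketch`,
S15, reshape 7): in case B, `3 ∣ ab(a+b)` and the Frey curve is multiplicative at `3`.**  For
coprime `a, b` with `ab(a+b) ≠ 0` (no normalisation needed): if no framed model of `E_(a,b)[3]`
is absolutely irreducible over `ℚ(√-3)`, then `3 ∣ ab(a+b)` — otherwise `E_(a,b)` has good
supersingular reduction at `3` and R3 (`isAbsIrreducibleOverSqrt_negThree_freyCurve_of_not_three_dvd`,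
p101774-era sibling file `…StubAbsIrrNegThree`) puts it in case A — and consequently `E_(a,b)`
has multiplicative reduction at the place `3` (`hasMultiplicativeReductionAt_freyCurve_of_ne_two`:
the integral Frey model is minimal at odd primes with `v₃(c₄) = 0 < v₃(Δ)`), i.e. `ρ_{E,3}` is
ordinary at `3`.  Side stub; does not feed `FreyModularity_of`.
[cite: DiamondKramer1995, Lemma 2] [cite: SkinnerWiles1999, Theorem (Introduction)] -/
theorem stub_freyCaseBMultiplicativeThree :
    ∀ (a b : ℤ) [(freyCurve a b).IsElliptic], IsCoprime a b → a * b * (a + b) ≠ 0 →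
      (∀ ρ₃ : ModPGaloisRep ℚ (ZMod 3) 2, (freyCurve a b).IsTorsionGaloisRep 3 ρ₃ →
        ¬ ρ₃.IsAbsIrreducibleOverSqrt (-3)) →
      (3 : ℤ) ∣ a * b * (a + b) ∧
        ∀ v : HeightOneSpectrum ℤ, Rat.HeightOneSpectrum.natGenerator v = 3 →
          (freyCurve a b).HasMultiplicativeReductionAt v := by
  intro a b _ hab h0 hB
  haveI : Fact (Nat.Prime 3) := ⟨Nat.prime_three⟩
  haveI : NeZero ((3 : ℕ) : ℚ) := ⟨by norm_num⟩
  obtain ⟨ρ, hρ⟩ := (freyCurve a b).exists_isTorsionGaloisRep 3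
  have h3 : (3 : ℤ) ∣ a * b * (a + b) := by
    by_contra h3
    exact hB ρ hρ (isAbsIrreducibleOverSqrt_negThree_freyCurve_of_not_three_dvd a b hab h0 h3 ρ hρ)
  refine ⟨h3, fun v hv ↦ ?_⟩
  refine hasMultiplicativeReductionAt_freyCurve_of_ne_two hab h0 v (by rw [hv]; decide) ?_
  rw [hv]
  exact_mod_cast h3

end Summit.ABC.ABC.Theorems

end
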